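import Summits.RiemannHypothesis.RiemannHypothesis.Theses.WeilWindowFlow
import Literature.NumberTheory.LFunctions.WeilGroundState
import Literature.NumberTheory.LFunctions.WeilSemilocalCompactnessProofs

/-!
# Load-bearing floors of the `cut-dont-squeeze` stub set (crux `WeilWindowFlow.WindowLipschitz`)

Negative knowledge for the crux `Summit.RiemannHypothesis.RiemannHypothesis.Theses.WeilWindowFlow.WindowLipschitz`
(item stmt-RiemannHypothesis-1039), line `cut-dont-squeeze` (skeleton
`Cruxes/WindowLipschitz/Lines/cut-dont-squeeze.lean`, rev 4): the two stubs that carry a CONSTANT uniform on a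
compact window range `[b₀, A]` — the sup bound (A) `stub_supBound` and the `L²` edge-mass law (B) (antecedent of
`stub_commutatorBound`, conclusion of the bridge `edgeMassLaw_of_pointwise`) — are FALSE when the floor `0 < b₀`
is removed (windows `a ∈ (0, 1]`), and their constants are quantitatively forced to blow up as `b₀ → 0⁺`:

* `one_le_sq_mul_of_ae_norm_le` — normalisation forces height: a ground state `u` of the window `a`
  (`∫ ‖u‖² = 1`, `u = 0` a.e. off `[−a, a]`) with `‖u‖ ≤ K` a.e. has `1 ≤ K² · 2a`;
* `supBound_constant_lower_bound` — hence every constant `K` of `stub_supBound` on `[b₀, A]` has `K² ≥ 1/(2b₀)`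
  (ground states exist: `ConnesConsaniMoscovici2025_thm_3_6_holds.exists_isWeilGroundState`, PROVED in the tree);
* `supBound_false_without_floor` — `stub_supBound`'s conclusion with the floor `b₀ ≤ a` replaced by `0 < a`
  (window range `(0, 1]`, stated inline) is false;
* `edgeMass_eq_one_of_radius_eq_window` — at radius `r = a` the "edge layer" `{a − r < |x|}` is `{x ≠ 0}`, which carries
  the whole mass `1` of the ground state;
* `edgeMassLaw_constant_lower_bound` — hence every pair `(K, d₀)` of the edge-mass law on `[b₀, A]` with `b₀ ≤ d₀`
  has `log(1/b₀) ≤ K · b₀`, i.e. `K ≥ log(1/b₀)/b₀`;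
* `edgeMassLaw_false_without_floor` — the edge-mass law with the floor removed (range `(0, 1]`, inline) is false.

So any proof of (A)/(B) must use `0 < b₀` (as the skeleton's docstrings say: through `ε(b₀)`), in line with the
disprover's crux-level `windowLipschitz_false_without_floor` / `lipschitzConstant_unbounded` (Disproof.lean,
refuter-cdisprove-stmt-RiemannHypothesis-1039-0).  refuter-drefute-stmt-RiemannHypothesis-1039-0, 2026-08-16.
-/

set_option linter.dupNamespace false

noncomputable section

open MeasureTheory Set Filter
open scoped Topology

namespace Summit.RiemannHypothesis.RiemannHypothesis.Theorems.CutDontSqueezeFloors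

open Literature.NumberTheory.LFunctions

/-- **Normalisation forces height.** If `u` is a ground state of the window `a` and `‖u‖ ≤ K` a.e., then
`1 = ∫‖u‖² = ∫_{[−a,a]} ‖u‖² ≤ K² · 2a`. [folklore] -/
theorem one_le_sq_mul_of_ae_norm_le {a K : ℝ} {u : ℝ → ℂ} (hu : IsWeilGroundState a u)
    (hK : ∀ᵐ x : ℝ, ‖u x‖ ≤ K) : 1 ≤ K ^ 2 * (2 * a) := by
  have ha : 0 < a := hu.pos
  have h1 : ∫ x, ‖u x‖ ^ 2 = 1 := hu.integral_norm_sq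
  have hind : ∀ᵐ x : ℝ, ‖u x‖ ^ 2 = (Icc (-a) a).indicator (fun x ↦ ‖u x‖ ^ 2) x := by
    filter_upwards [hu.ae_eq_zero_of_notMem] with x hx
    by_cases hm : x ∈ Icc (-a) a
    · simp [hm]
    · simp [hm, hx hm]
  have h2 : ∫ x, ‖u x‖ ^ 2 = ∫ x in Icc (-a) a, ‖u x‖ ^ 2 := by
    rw [integral_congr_ae hind, integral_indicator measurableSet_Icc]
  have hfin : volume (Icc (-a) a) < ⊤ := by
    rw [Real.volume_Icc]
    exact ENNReal.ofReal_lt_top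
  have hbd : ∀ᵐ x : ℝ, x ∈ Icc (-a) a → ‖(‖u x‖ ^ 2 : ℝ)‖ ≤ K ^ 2 := by
    filter_upwards [hK] with x hx _
    rw [Real.norm_of_nonneg (by positivity)]
    exact pow_le_pow_left₀ (norm_nonneg _) hx 2
  have h3 := norm_setIntegral_le_of_norm_le_const_ae' hfin hbd
  have hvol : volume.real (Icc (-a) a) = 2 * a := by
    rw [Real.volume_real_Icc_of_le (by linarith)]
    ring
  calc (1 : ℝ) = ∫ x in Icc (-a) a, ‖u x‖ ^ 2 := by rw [← h2, h1]
    _ ≤ ‖∫ x in Icc (-a) a, ‖u x‖ ^ 2‖ := Real.le_norm_self _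
    _ ≤ K ^ 2 * volume.real (Icc (-a) a) := h3
    _ = K ^ 2 * (2 * a) := by rw [hvol]

/-- **Tightness of the sup-bound constant.** Any constant `K` that bounds every ground state of every window
`a ∈ [b₀, A]` a.e. (the conclusion of `stub_supBound` at `(b₀, A)`) satisfies `1 ≤ K² · 2b₀`, i.e.
`K ≥ (2b₀)^{-1/2} → ∞` as `b₀ → 0⁺`. [folklore] -/
theorem supBound_constant_lower_bound {b₀ A K : ℝ} (hb₀ : 0 < b₀) (hA : b₀ ≤ A)
    (hK : ∀ (a : ℝ) (u : ℝ → ℂ), b₀ ≤ a → a ≤ A → IsWeilGroundState a u →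
      ∀ᵐ x : ℝ, ‖u x‖ ≤ K) :
    1 ≤ K ^ 2 * (2 * b₀) := by
  obtain ⟨u, hu⟩ := ConnesConsaniMoscovici2025_thm_3_6_holds.exists_isWeilGroundState hb₀
  exact one_le_sq_mul_of_ae_norm_le hu (hK b₀ u le_rfl hA hu)

/-- **The floor `0 < b₀` is load-bearing for the sup bound (A):** no single constant bounds the ground states
of all windows `a ∈ (0, 1]` (at `a = 1/(4(K²+1))` the normalisation forces `‖u‖_∞ > K`). [folklore] -/
theorem supBound_false_without_floor :
    ¬ ∃ K : ℝ, ∀ (a : ℝ) (u : ℝ → ℂ), 0 < a → a ≤ 1 → IsWeilGroundState a u →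
      ∀ᵐ x : ℝ, ‖u x‖ ≤ K := by
  rintro ⟨K, hK⟩
  have hK2 : 0 < K ^ 2 + 1 := by positivity
  set a : ℝ := 1 / (4 * (K ^ 2 + 1)) with ha_def
  have ha : 0 < a := by positivity
  have ha1 : a ≤ 1 := by
    rw [ha_def, div_le_one (by positivity)]
    nlinarith
  obtain ⟨u, hu⟩ := ConnesConsaniMoscovici2025_thm_3_6_holds.exists_isWeilGroundState ha
  have h := one_le_sq_mul_of_ae_norm_le hu (hK a u ha ha1 hu)
  have hlt : K ^ 2 * (2 * a) < 1 := by
    have e : K ^ 2 * (2 * a) = K ^ 2 / (2 * (K ^ 2 + 1)) := by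
      rw [ha_def]
      field_simp
      ring
    rw [e, div_lt_one (by positivity)]
    nlinarith
  linarith

/-- **At radius `r = a` the edge layer carries the whole mass**: `{a − a < |x|} = {x ≠ 0}` is co-null, so
`∫_{a−a<|x|} ‖u‖² = ∫ ‖u‖² = 1` for a ground state `u`. [folklore] -/
theorem edgeMass_eq_one_of_radius_eq_window {a : ℝ} {u : ℝ → ℂ} (hu : IsWeilGroundState a u) :
    ∫ x in {x : ℝ | a - a < |x|}, ‖u x‖ ^ 2 = 1 := by
  have hset : {x : ℝ | a - a < |x|} = {(0 : ℝ)}ᶜ := by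
    ext x
    simp [sub_self, abs_pos]
  rw [hset, restrict_compl_singleton, hu.integral_norm_sq]

/-- **Tightness of the edge-mass constant.** If `(K, d₀)` realise the `L²` edge-mass law on `[b₀, A]`
(the antecedent (B) of `stub_commutatorBound`) and `b₀ ≤ d₀`, then `log(1/b₀) ≤ K · b₀` (take `a = r = b₀`):
the constant `K(b₀, A) ≥ log(1/b₀)/b₀ → ∞` as `b₀ → 0⁺`. [folklore] -/
theorem edgeMassLaw_constant_lower_bound {b₀ A K d₀ : ℝ} (hb₀ : 0 < b₀) (hA : b₀ ≤ A) (hd : b₀ ≤ d₀)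
    (hd₀1 : d₀ < 1)
    (hK : ∀ (a r : ℝ) (u : ℝ → ℂ), b₀ ≤ a → a ≤ A → IsWeilGroundState a u → 0 < r → r ≤ d₀ →
      ∫ x in {x : ℝ | a - r < |x|}, ‖u x‖ ^ 2 ≤ K * r / Real.log (1 / r)) :
    Real.log (1 / b₀) ≤ K * b₀ := by
  obtain ⟨u, hu⟩ := ConnesConsaniMoscovici2025_thm_3_6_holds.exists_isWeilGroundState hb₀
  have h := hK b₀ b₀ u le_rfl hA hu hb₀ hd
  rw [edgeMass_eq_one_of_radius_eq_window hu] at h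
  have hlog : 0 < Real.log (1 / b₀) := by
    apply Real.log_pos
    rw [lt_div_iff₀ hb₀, one_mul]
    exact lt_of_le_of_lt hd hd₀1
  rwa [le_div_iff₀ hlog, one_mul] at h

/-- **The floor `0 < b₀` is load-bearing for the edge-mass law (B):** on the window range `(0, 1]` no pair
`(K, d₀)` works — at `a = r = min d₀ (min (1/2) (1/(4(|K|+1))))` the layer carries mass `1` while
`K r / log(1/r) < 1/2`. [folklore] -/
theorem edgeMassLaw_false_without_floor :
    ¬ ∃ K d₀ : ℝ, 0 < d₀ ∧ d₀ < 1 ∧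
      ∀ (a r : ℝ) (u : ℝ → ℂ), 0 < a → a ≤ 1 → IsWeilGroundState a u → 0 < r → r ≤ d₀ →
        ∫ x in {x : ℝ | a - r < |x|}, ‖u x‖ ^ 2 ≤ K * r / Real.log (1 / r) := by
  rintro ⟨K, d₀, hd₀, hd₀1, hK⟩
  have hK1 : 0 < |K| + 1 := by positivity
  set a : ℝ := min d₀ (min (1 / 2) (1 / (4 * (|K| + 1)))) with ha_def
  have ha : 0 < a := lt_min hd₀ (lt_min (by norm_num) (by positivity))
  have had : a ≤ d₀ := min_le_left _ _
  have ha2 : a ≤ 1 / 2 := (min_le_right _ _).trans (min_le_left _ _)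
  have haK : a ≤ 1 / (4 * (|K| + 1)) := (min_le_right _ _).trans (min_le_right _ _)
  have ha1 : a ≤ 1 := by linarith
  obtain ⟨u, hu⟩ := ConnesConsaniMoscovici2025_thm_3_6_holds.exists_isWeilGroundState ha
  have h := hK a a u ha ha1 hu ha had
  rw [edgeMass_eq_one_of_radius_eq_window hu] at h
  -- `log(1/a) ≥ log 2 > 1/2`
  have hlog : 1 / 2 < Real.log (1 / a) := by
    have h2 : (2 : ℝ) ≤ 1 / a := by
      rw [le_div_iff₀ ha]
      linarith
    have hlog2 : (1 : ℝ) / 2 < Real.log 2 := by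
      have := Real.log_two_gt_d9
      linarith
    exact lt_of_lt_of_le hlog2 (Real.log_le_log (by norm_num) h2)
  have hlogpos : 0 < Real.log (1 / a) := by linarith
  -- `K a ≤ |K| a ≤ 1/4`
  have hKa : K * a ≤ 1 / 4 := by
    calc K * a ≤ |K| * a := mul_le_mul_of_nonneg_right (le_abs_self K) ha.le
      _ ≤ |K| * (1 / (4 * (|K| + 1))) := mul_le_mul_of_nonneg_left haK (abs_nonneg K)
      _ = (|K| / (|K| + 1)) * (1 / 4) := by
          field_simp
      _ ≤ 1 * (1 / 4) := by
          apply mul_le_mul_of_nonneg_right _ (by norm_num)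
          rw [div_le_one hK1]
          linarith
      _ = 1 / 4 := one_mul _
  have hlt : K * a / Real.log (1 / a) < 1 := by
    rw [div_lt_one hlogpos]
    linarith
  linarith

end Summit.RiemannHypothesis.RiemannHypothesis.Theorems.CutDontSqueezeFloors

end
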